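import Literature.Computability.Complexity.CircuitRestriction
import HarnessLib

/-!
# Negations are (almost) free in size for `AC⁰` circuits: the De Morgan normal form

For circuits over the unbounded fan-in basis `acBasis = {¬} ∪ {∧ₖ, ∨ₖ : k ∈ ℕ}` the tree has TWO size
conventions: `Circuit.size` (every gate counts; used by `DepthSizeClass`, `ACd`, `AC0`) and
`Circuit.sizeWith acWeight` (negation gates weigh `0`; used e.g. by the device classes `acFns` of the
average-case magnification rows).  A circuit may contain arbitrarily long chains of `¬` gates, so
`size` is NOT bounded in terms of `sizeWith acWeight` for a GIVEN circuit — but it is up to rewriting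
the circuit: pushing the negations to the inputs by De Morgan's laws ("we may assume all negations
are at the input level", Arora–Barak 2009, §14.1 proof of Thm. 14.1 / Håstad 1986, §2; Vollmer 1999,
§1.2, Jukna 2012, §1.1 — the *standard normal form* of `AC⁰` circuits) gives an equivalent circuit
over `acBasis` with

* at most `N + 2·sizeWith acWeight` gates (`N` negated literals `¬xᵢ`, and for every `∧`/`∨` gate
  `g` one gate computing `g` and one computing `¬g`), and
* no larger `acWeight`-depth (`acDepth`),

computing the same function (`Circuit.exists_nnf`; the degenerate case of a circuit whose output
is a constant after normalisation needs the one gate `∧₀`/`∨₀`, whence the `max … 1`).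

Everything here is PROVED, by the gate-by-gate translation technique of `CircuitRestriction.lean`
(`GateList.RTrans`: a wire of the new program carrying a prescribed function at a prescribed
`acWeight`-depth, or a constant; `GateList.RTrans.acOp`: one new `∧`/`∨` gate on translated
arguments): every gate of the old program is translated TWICE, positively and negatively
(`GateList.nnfElim`), a `¬` gate costing nothing (swap the two translations of its argument), an
`∧ₖ`/`∨ₖ` gate costing at most two new gates (`∧` of the positive / `∨` of the negative translations
of the arguments, and dually), after a prefix of the `N` negated literals.  Mathlib has no Boolean
circuits; the statement is folklore.

Used by `Literature/Computability/MetaComplexity/MCSPGapAC0WorstCaseShadow.lean` (hardness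
magnification gap census, item G33: eventual negation-free `acFns` devices on the slices of a language
of truth tables ⇒ membership in `ACd`, whence the typed worst-case `AC⁰` lower bound for `MCSP[n^c]`
yields the worst-case shadow of the average-case threshold of census row R68).

## References

* S. Arora, B. Barak, *Computational Complexity: A Modern Approach* (2009), §14.1 (normal form of
  `AC⁰` circuits in the proof of Thm. 14.1).
* J. Håstad, *Almost optimal lower bounds for small depth circuits*, STOC 1986, §2.
* H. Vollmer, *Introduction to Circuit Complexity* (1999), §1.2; S. Jukna, *Boolean Function
  Complexity* (2012), §1.1 (De Morgan rules, negations at the leaves).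
-/

namespace Literature.Computability.Complexity

open Finset GateList

namespace GateList

variable {ι : Type*}

/-! ### De Morgan on gate truth tables -/

/-- `∨ₖ` of the negated arguments is the negation of `∧ₖ`. [folklore] -/
theorem decide_exists_not_eq {k : ℕ} (v : Fin k → Bool) :
    decide (∃ a, (!v a) = true) = !decide (∀ a, v a = true) := by
  rw [Bool.eq_iff_iff]
  simp

/-- `∧ₖ` of the negated arguments is the negation of `∨ₖ`. [folklore] -/
theorem decide_forall_not_eq {k : ℕ} (v : Fin k → Bool) :
    decide (∀ a, (!v a) = true) = !decide (∃ a, v a = true) := by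
  rw [Bool.eq_iff_iff]
  simp

/-! ### The prefix of negated literals -/

/-- The first `k` negated literals `¬x₀, …, ¬x_{k-1}` as a well-formed program over `acBasis` of
length `k`, gate `i` carrying `¬xᵢ` at `acWeight`-depth `0`. [folklore] -/
theorem exists_negLiterals (N : ℕ) : ∀ k, k ≤ N →
    ∃ ns : List (Gate (Fin N)), WF ns ∧ (∀ g ∈ ns, g.fn ∈ acBasis) ∧ ns.length = k ∧
      ∀ i : Fin N, i.1 < k → RTrans ns (fun x => !x i) 0 (.inr (.inr i.1))
  | 0, _ => ⟨[], WF.nil, by simp, rfl, fun i hi => absurd hi (Nat.not_lt_zero _)⟩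
  | k + 1, hk => by
    obtain ⟨ns, hwf, hB, hlen, hlit⟩ := exists_negLiterals N k (Nat.le_of_succ_le hk)
    have hkN : k < N := hk
    refine ⟨ns ++ [notGate (.inl ⟨k, hkN⟩)], hwf.append_singleton (fun _ m hm => by cases hm),
      fun g hg => ?_, by simp [hlen], fun i hi => ?_⟩
    · simp only [List.mem_append, List.mem_singleton] at hg
      rcases hg with hg | rfl
      · exact hB g hg
      · rw [notGate_fn]; exact mem_acBasis_not
    · by_cases hik : i.1 < k
      · exact (hlit i hik).append
      · have hi' : i.1 = k := by omega
        have hii : (⟨k, hkN⟩ : Fin N) = i := Fin.ext hi'.symm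
        rw [hii]
        refine RTrans.inr_iff.2 ⟨fun m hm => ?_, fun x => ?_, ?_⟩
        · cases hm; simp [hlen, hi']
        · simp only [wireOf_inr]
          rw [hi', ← hlen, getD_vals_append_singleton]
          rfl
        · simp only [wireDepthOf_inr]
          rw [hi', ← hlen, getD_wdepths_append_singleton, notGate_fn, acWeight_not, zero_add]
          exact Finset.sup_le fun a _ => by simp [notGate]

/-! ### Positive and negative translation of every gate -/

/-- Positive translation of an old wire: an input stays, a gate goes to its positive token. [folklore] -/
def posTok {N : ℕ} (φ : ℕ → (Bool ⊕ (Fin N ⊕ ℕ)) × (Bool ⊕ (Fin N ⊕ ℕ))) :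
    Fin N ⊕ ℕ → Bool ⊕ (Fin N ⊕ ℕ)
  | .inl i => .inr (.inl i)
  | .inr m => (φ m).1

/-- Negative translation of an old wire: input `i` goes to the negated literal (gate `i` of the
prefix), a gate to its negative token. [folklore] -/
def negTok {N : ℕ} (φ : ℕ → (Bool ⊕ (Fin N ⊕ ℕ)) × (Bool ⊕ (Fin N ⊕ ℕ))) :
    Fin N ⊕ ℕ → Bool ⊕ (Fin N ⊕ ℕ)
  | .inl i => .inr (.inr i.1)
  | .inr m => (φ m).2

/-- **De Morgan normalisation of a straight-line program over `acBasis`.** For every well-formed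
program `ms` over `acBasis` on `N` inputs there is a program `ns` over `acBasis` with at most
`N + 2·Σ_{g ∈ ms} acWeight g` gates (i.e. `N` plus twice the number of `∧`/`∨` gates of `ms`) in
which the `N` negated literals and, for every gate of `ms`, both the gate's function AND its
negation are constants or carried by wires of no larger `acWeight`-depth. [folklore] -/
theorem nnfElim {N : ℕ} (ms : List (Gate (Fin N))) (hwf : WF ms) (hB : ∀ g ∈ ms, g.fn ∈ acBasis) :
    ∃ (ns : List (Gate (Fin N))) (φ : ℕ → (Bool ⊕ (Fin N ⊕ ℕ)) × (Bool ⊕ (Fin N ⊕ ℕ))),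
      WF ns ∧ (∀ g ∈ ns, g.fn ∈ acBasis) ∧
      ns.length ≤ N + 2 * (ms.map fun g => acWeight g.fn).sum ∧
      (∀ i : Fin N, RTrans ns (fun x => !x i) 0 (.inr (.inr i.1))) ∧
      ∀ m < ms.length,
        RTrans ns (fun x => (vals ms x).getD m false) ((wdepths acWeight ms).getD m 0) (φ m).1 ∧
        RTrans ns (fun x => !(vals ms x).getD m false) ((wdepths acWeight ms).getD m 0) (φ m).2 := by
  classical
  induction ms using List.reverseRecOn with
  | nil =>
    obtain ⟨ns, hwf', hB', hlen, hlit⟩ := exists_negLiterals N N le_rfl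
    exact ⟨ns, fun _ => (.inl false, .inl true), hwf', hB', by simp [hlen], fun i => hlit i i.2,
      fun m hm => absurd hm (by simp)⟩
  | append_singleton ms g ih =>
    obtain ⟨ns, φ, hwf', hB', hlen, hlit, hφ⟩ :=
      ih hwf.of_append_left fun g hg => hB g (List.mem_append_left _ hg)
    have hgB : g.fn ∈ acBasis := hB g (by simp)
    have hgOK : GateOK ms.length g := hwf.gateOK_mid (post := [])
    -- translations of the argument wires of `g`
    have hτp : ∀ u : Fin N ⊕ ℕ, OutOK ms.length u →
        RTrans ns (fun x => wireOf x (vals ms x) u) (wireDepthOf (wdepths acWeight ms) u)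
          (posTok φ u) := by
      rintro (i | m) hu
      · exact RTrans.inr_iff.2 ⟨fun m hm => (by cases hm), fun x => rfl, by simp⟩
      · exact (hφ m (hu m rfl)).1
    have hτn : ∀ u : Fin N ⊕ ℕ, OutOK ms.length u →
        RTrans ns (fun x => !wireOf x (vals ms x) u) (wireDepthOf (wdepths acWeight ms) u)
          (negTok φ u) := by
      rintro (i | m) hu
      · exact RTrans.congr (fun x => rfl) (by simp) (hlit i)
      · exact (hφ m (hu m rfl)).2
    -- old gates keep their translations in any extension of `ns`
    have hold : ∀ (sfx : List (Gate (Fin N))) (m : ℕ), m < ms.length →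
        RTrans (ns ++ sfx) (fun x => (vals (ms ++ [g]) x).getD m false)
          ((wdepths acWeight (ms ++ [g])).getD m 0) (φ m).1 ∧
        RTrans (ns ++ sfx) (fun x => !(vals (ms ++ [g]) x).getD m false)
          ((wdepths acWeight (ms ++ [g])).getD m 0) (φ m).2 := by
      intro sfx m hm
      have hv : ∀ x, (vals (ms ++ [g]) x).getD m false = (vals ms x).getD m false := fun x =>
        wireOf_vals_append ms [g] x (.inr m) (fun m' h => by cases h; exact hm)
      have hd : (wdepths acWeight (ms ++ [g])).getD m 0 = (wdepths acWeight ms).getD m 0 :=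
        wireDepthOf_wdepths_append acWeight ms [g] (.inr m) (fun m' h => by cases h; exact hm)
      exact ⟨(RTrans.congr (fun x => (hv x).symm) hd.symm.le (hφ m hm).1).append,
        (RTrans.congr (fun x => by rw [hv]) hd.symm.le (hφ m hm).2).append⟩
    -- the value and the depth of the new gate
    have hnew : ∀ x, (vals (ms ++ [g]) x).getD ms.length false =
        g.op (fun a => wireOf x (vals ms x) (g.args a)) := fun x => getD_vals_append_singleton ms g x
    have hdep : (wdepths acWeight (ms ++ [g])).getD ms.length 0 =
        acWeight g.fn + univ.sup fun a => wireDepthOf (wdepths acWeight ms) (g.args a) :=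
      getD_wdepths_append_singleton acWeight ms g
    have hsum : ((ms ++ [g]).map fun g => acWeight g.fn).sum =
        (ms.map fun g => acWeight g.fn).sum + acWeight g.fn := by simp
    -- assembling from translations `τp`, `τn` of the new gate and its negation
    have finish : ∀ (sfx : List (Gate (Fin N))) (τp τn : Bool ⊕ (Fin N ⊕ ℕ)), WF (ns ++ sfx) →
        (∀ g' ∈ ns ++ sfx, g'.fn ∈ acBasis) → sfx.length ≤ 2 * acWeight g.fn →
        RTrans (ns ++ sfx) (fun x => (vals (ms ++ [g]) x).getD ms.length false)
          ((wdepths acWeight (ms ++ [g])).getD ms.length 0) τp →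
        RTrans (ns ++ sfx) (fun x => !(vals (ms ++ [g]) x).getD ms.length false)
          ((wdepths acWeight (ms ++ [g])).getD ms.length 0) τn →
        ∃ (ns' : List (Gate (Fin N))) (φ' : ℕ → (Bool ⊕ (Fin N ⊕ ℕ)) × (Bool ⊕ (Fin N ⊕ ℕ))),
          WF ns' ∧ (∀ g' ∈ ns', g'.fn ∈ acBasis) ∧
          ns'.length ≤ N + 2 * ((ms ++ [g]).map fun g => acWeight g.fn).sum ∧
          (∀ i : Fin N, RTrans ns' (fun x => !x i) 0 (.inr (.inr i.1))) ∧
          ∀ m < (ms ++ [g]).length,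
            RTrans ns' (fun x => (vals (ms ++ [g]) x).getD m false)
              ((wdepths acWeight (ms ++ [g])).getD m 0) (φ' m).1 ∧
            RTrans ns' (fun x => !(vals (ms ++ [g]) x).getD m false)
              ((wdepths acWeight (ms ++ [g])).getD m 0) (φ' m).2 := by
      intro sfx τp τn hwf'' hB'' hsfx hτp' hτn'
      refine ⟨ns ++ sfx, fun m => if m = ms.length then (τp, τn) else φ m, hwf'', hB'', ?_,
        fun i => (hlit i).append, fun m hm => ?_⟩
      · rw [hsum, List.length_append]; omega
      · by_cases hmeq : m = ms.length
        · subst hmeq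
          simp only [if_true]
          exact ⟨hτp', hτn'⟩
        · simp only [hmeq, ↓reduceIte]
          exact hold sfx m (by simp at hm; omega)
    rcases (mem_acBasis_iff _).1 hgB with hc | ⟨k, hc | hc⟩
    · -- `¬` gate: swap the two translations of the argument, no new gate
      obtain ⟨u, rfl⟩ := exists_eq_notGate_of_fn_eq hc
      have hu : OutOK ms.length u := fun m hm => hgOK (0 : Fin 1) m hm
      have hd0 : (wdepths acWeight (ms ++ [notGate u])).getD ms.length 0 =
          wireDepthOf (wdepths acWeight ms) u := by
        rw [hdep, notGate_fn, acWeight_not, zero_add]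
        exact Finset.sup_const (Finset.univ_nonempty (α := Fin 1)) _
      refine finish [] (negTok φ u) (posTok φ u) (by simpa using hwf') (by simpa using hB')
        (by simp) ?_ ?_
      · refine RTrans.congr (fun x => ?_) hd0.symm.le (hτn u hu).append
        rw [hnew]; rfl
      · refine RTrans.congr (fun x => ?_) hd0.symm.le (hτp u hu).append
        rw [hnew]
        show wireOf x (vals ms x) u = !!(wireOf x (vals ms x) u)
        rw [Bool.not_not]
    · -- `∧ₖ` gate: `∧` of the positive translations, `∨` of the negative ones
      obtain ⟨args, rfl⟩ := Gate.exists_eq_of_fn_eq hc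
      have hargs : ∀ a : Fin k, OutOK ms.length (args a) := fun a m hm => hgOK a m hm
      obtain ⟨sfx₁, τp, hwf₁, hB₁, hsfx₁, hτp'⟩ :=
        RTrans.acOp true hwf' hB' (fun a => hτp (args a) (hargs a))
      obtain ⟨sfx₂, τn, hwf₂, hB₂, hsfx₂, hτn'⟩ :=
        RTrans.acOp false hwf₁ hB₁ (fun a => (hτn (args a) (hargs a)).append)
      rw [List.append_assoc] at hwf₂ hB₂ hτn'
      refine finish (sfx₁ ++ sfx₂) τp τn hwf₂ hB₂ ?_ ?_ ?_
      · show (sfx₁ ++ sfx₂).length ≤ 2 * acWeight (GateFn.and k)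
        rw [acWeight_and, List.length_append]; omega
      · have hτp'' := hτp'.append (sfx := sfx₂)
        rw [List.append_assoc] at hτp''
        refine RTrans.congr (fun x => ?_) (le_of_eq ?_) hτp''
        · rw [hnew]; simp [GateFn.and]
        · rw [hdep]
          show 1 + _ = acWeight (GateFn.and k) + _
          rw [acWeight_and]
      · refine RTrans.congr (fun x => ?_) (le_of_eq ?_) hτn'
        · rw [hnew]
          simp only [Bool.false_eq_true, ↓reduceIte]
          exact decide_exists_not_eq _
        · rw [hdep]
          show 1 + _ = acWeight (GateFn.and k) + _
          rw [acWeight_and]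
    · -- `∨ₖ` gate: `∨` of the positive translations, `∧` of the negative ones
      obtain ⟨args, rfl⟩ := Gate.exists_eq_of_fn_eq hc
      have hargs : ∀ a : Fin k, OutOK ms.length (args a) := fun a m hm => hgOK a m hm
      obtain ⟨sfx₁, τp, hwf₁, hB₁, hsfx₁, hτp'⟩ :=
        RTrans.acOp false hwf' hB' (fun a => hτp (args a) (hargs a))
      obtain ⟨sfx₂, τn, hwf₂, hB₂, hsfx₂, hτn'⟩ :=
        RTrans.acOp true hwf₁ hB₁ (fun a => (hτn (args a) (hargs a)).append)
      rw [List.append_assoc] at hwf₂ hB₂ hτn'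
      refine finish (sfx₁ ++ sfx₂) τp τn hwf₂ hB₂ ?_ ?_ ?_
      · show (sfx₁ ++ sfx₂).length ≤ 2 * acWeight (GateFn.or k)
        rw [acWeight_or, List.length_append]; omega
      · have hτp'' := hτp'.append (sfx := sfx₂)
        rw [List.append_assoc] at hτp''
        refine RTrans.congr (fun x => ?_) (le_of_eq ?_) hτp''
        · rw [hnew]; simp [GateFn.or]
        · rw [hdep]
          show 1 + _ = acWeight (GateFn.or k) + _
          rw [acWeight_or]
      · refine RTrans.congr (fun x => ?_) (le_of_eq ?_) hτn'
        · rw [hnew]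
          simp only [↓reduceIte]
          exact decide_forall_not_eq _
        · rw [hdep]
          show 1 + _ = acWeight (GateFn.or k) + _
          rw [acWeight_or]

end GateList

/-- **De Morgan normal form of `AC⁰` circuits** (Arora–Barak 2009, §14.1; Håstad 1986, §2): a
circuit over `acBasis` on `N` inputs is equivalent to one over `acBasis` with at most
`N + 2·sizeWith acWeight` gates — ALL gates counted — and no larger `acDepth` (`max … 1` covers the
degenerate constant case, realised by the single gate `∧₀`/`∨₀`).  In particular the two size
conventions of the tree (`size` vs. `sizeWith acWeight`, negations free) agree up to the factor `2`
and the additive `N`. [cite: AroraBarak2009, §14.1 (negations at the input level)] -/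
theorem Circuit.exists_nnf {N : ℕ} (C : Circuit (Fin N)) (hC : C.IsOver acBasis) :
    ∃ C' : Circuit (Fin N), C'.IsOver acBasis ∧ C'.size ≤ max (N + 2 * C.sizeWith acWeight) 1 ∧
      C'.acDepth ≤ max C.acDepth 1 ∧ ∀ x, C'.eval x = C.eval x := by
  obtain ⟨ns, φ, hwf', hB', hlen, -, hφ⟩ := nnfElim C.gates (wf_gates C) hC
  have ho : OutOK C.gates.length C.output := C.wf_output
  have h1 : ∀ x, C.eval x = wireOf x (vals C.gates x) C.output := fun x => circuit_eval C _
  have h2 : C.acDepth = wireDepthOf (wdepths acWeight C.gates) C.output := circuit_depthWith C _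
  have hτ : RTrans ns (fun x => C.eval x) C.acDepth (posTok φ C.output) := by
    rcases hCo : C.output with i | m
    · rw [hCo] at h1
      show RTrans ns (fun x => C.eval x) C.acDepth (.inr (.inl i))
      exact RTrans.inr_iff.2 ⟨fun m hm => (by cases hm), fun x => (by rw [h1]; rfl), by simp⟩
    · rw [hCo] at h1 h2 ho
      exact RTrans.congr (fun x => (h1 x).symm) (le_of_eq h2.symm) (hφ m (ho m rfl)).1
  revert hτ
  rcases posTok φ C.output with b | u
  · intro hb
    refine ⟨Circuit.const _ b, Circuit.const_isOver_acBasis b, ?_, ?_, fun x => ?_⟩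
    · rw [Circuit.size_const]; exact le_max_right _ _
    · rw [Circuit.acDepth_const]; exact le_max_right _ _
    · rw [Circuit.eval_const]; exact (RTrans.inl_iff.1 hb x).symm
  · intro hu
    obtain ⟨huok, hval, hdep⟩ := RTrans.inr_iff.1 hu
    refine ⟨toCircuit ns u hwf' huok, hB', ?_, ?_, fun x => ?_⟩
    · exact le_trans hlen (le_max_left _ _)
    · refine le_trans ?_ (le_max_left _ _)
      rw [Circuit.acDepth, circuit_depthWith]
      exact hdep
    · rw [circuit_eval]; exact (hval x).symm

/-- The normal form with prescribed bounds: `acDepth ≤ d` and `sizeWith acWeight ≤ s` give an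
equivalent circuit over `acBasis` of `acDepth ≤ max d 1` and `size ≤ max (N + 2 s) 1`. [folklore] -/
theorem Circuit.exists_nnf_of_le {N d s : ℕ} (C : Circuit (Fin N)) (hC : C.IsOver acBasis)
    (hd : C.acDepth ≤ d) (hs : C.sizeWith acWeight ≤ s) :
    ∃ C' : Circuit (Fin N), C'.IsOver acBasis ∧ C'.size ≤ max (N + 2 * s) 1 ∧
      C'.acDepth ≤ max d 1 ∧ ∀ x, C'.eval x = C.eval x := by
  obtain ⟨C', hB, hsz, hdp, hev⟩ := C.exists_nnf hC
  exact ⟨C', hB, hsz.trans (max_le_max (by omega) le_rfl), hdp.trans (max_le_max hd le_rfl), hev⟩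

end Literature.Computability.Complexity
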